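import Literature.Probability.LatticeModels.IsoradialPercolation
import Literature.Probability.Percolation.Percolation
import HarnessLib
import HarnessLib.Audit.Tags

/-!
# QUANT lane, statements only (R0.d): the linear lower-tail gluing family `QuantLowerTailGluingAt λ C` (Q-AG1)

builds on p205010 (kernel theorem, internal audit signed; external expert review pending)

Cell `prim-quant` (post-continuity programme, LANE 1), typer seat `prim-quant-stmt`; rung R0.d / R1 of
`run/shared/lean/prim/quant/LADDER.md`.  Nothing is proved here.  Vocabulary verbatim from the route items
`PercNearOneGluing.AdditiveGluing` / `NoHeavyLowerTail` (`Summits/…/Theses/PercNearOneGluing.lean`): finite weighted graphs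
on `Fin n` with weights `w : Sym2 (Fin n) → [0,1]`, measure `prodBernoulli w`, events `openConn`, the number of relays joined
to the observer `N(ω) = #(A.filter (ω ∈ openConn o ·))` and its mean `EN = Σ_{a∈A} P(o ↔ a)`.

* `Quant.QuantLowerTailGluingAt lam C` — for every finite weighted graph, relay set `A`, observer `o ∉ A` and slack `s ≥ 0` with
  `P(a ↮ a') ≤ s` for all `a, a' ∈ A`:  `P(1 ≤ N < lam · EN) ≤ C · (P(o ↮ A) + s)`.
* `Quant.QuantLowerTailGluing C := QuantLowerTailGluingAt (1/2) C` — QUANT.md §5's candidate Q-AG1 ("linear λ-uniform lower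
  tail", the linear form of `NoHeavyLowerTail`, whose tree `δ(ε)` is implicit).

STATUS NOTE (typer, 2026-08-20, `HOME/prim-quant-stmt/QAG1-NOTE.md`): for `0 ≤ lam < 1` the instance
`QuantLowerTailGluingAt lam (1/(1-lam))` FOLLOWS from the tree theorem `AdditiveGluing` (p205010 cone) by a Markov step —
AdditiveGluing with target `b := a` gives `P(o ↔ A, o ↮ a) ≤ s` for each relay, so `E[|A| - N; o ↔ A] ≤ |A|·s`, while `EN ≤ |A|`
makes `{1 ≤ N < lam·EN} ⊆ {o ↔ A} ∩ {|A| - N > (1-lam)|A|}`.  So `QuantLowerTailGluing 2` is PROVABLE NOW (not yet landed; the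
lead assigns the prover), the census question "sharp C" lives in `[1, 2]`, and instances with `C < 1/(1-lam)` or `lam ≥ 1` are the
only ones a census can refute.  The family is typed with both parameters so that every proved / refuted constant is a statement
about a named instance (`QuantLowerTailGluingAt lam C` / `¬ QuantLowerTailGluingAt lam C`).

Design: the pairwise slack enters as a parameter `s` with `∀ a a', P(a ↮ a') ≤ s` (as `t` does in `AdditiveGluing`) instead of a
`Finset.sup'` over a possibly empty `A` (`0 ≤ s` explicit, as `0 ≤ t` in `AdditiveGluing`, so that `A = ∅` carries no junk instance); `open scoped Classical` supplies the decidability of `ω ∈ openConn o a`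
exactly as in the route file `Theses/PercNearOneGluing.lean` (so `N` is the route's `N` syntactically); complements `(…)ᶜ` are the "not joined" events; `o ∉ A` as in LADDER R1 (for `o ∈ A`,
`N ≥ 1` always and the statement changes meaning).
-/

noncomputable section

namespace Summit.CriticalPhenomena.PercolationContinuityZ3.Theorems.Quant

open Literature.Probability.LatticeModels Literature.Probability.Percolation
open scoped Classical

/-- **(R0.d, Q-AG1 with threshold fraction `lam` and constant `C`) Linear lower-tail gluing on finite weighted graphs:**
for every `n`, weights `w : Sym2 (Fin n) → [0,1]`, relay set `A`, observer `o ∉ A` and slack `s ≥ 0` with `s ≥ max_{a,a'∈A} P(a ↮ a')`,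
`P(1 ≤ N < lam · EN) ≤ C · (P(o ↮ A) + s)`, where `N(ω) = #{a ∈ A | o ↔ a in ω}` and `EN = Σ_{a∈A} P(o ↔ a)` (measure
`prodBernoulli w`, events `openConn`).  Known (typer's note QAG1-NOTE.md, argument only): true with `C = 1/(1 - lam)` for
`0 ≤ lam < 1` from `AdditiveGluing` + Markov; the sharp `C` at `lam = 1/2` lies in `[1, 2]`.
builds on p205010 (kernel theorem, internal audit signed; external expert review pending).
[cite: KozmaNitzan2024, Conj. 1 (p. 3) and Conjecture 3 (p. 15) (the gluing inequalities this quantifies)] -/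
@[conjecture] def QuantLowerTailGluingAt (lam C : ℝ) : Prop :=
  ∀ (n : ℕ) (w : Sym2 (Fin n) → unitInterval) (A : Finset (Fin n)) (o : Fin n) (s : ℝ), o ∉ A → 0 ≤ s →
    (∀ a ∈ A, ∀ a' ∈ A, (prodBernoulli w).real (openConn a a')ᶜ ≤ s) →
    (prodBernoulli w).real {ω | 1 ≤ (A.filter fun a => ω ∈ openConn o a).card ∧
        ((A.filter fun a => ω ∈ openConn o a).card : ℝ) <
          lam * ∑ a ∈ A, (prodBernoulli w).real (openConn o a)} ≤
      C * ((prodBernoulli w).real (⋃ a ∈ A, openConn o a)ᶜ + s)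

/-- **(R0.d, Q-AG1 as in QUANT.md §5 / LADDER R1) `P(1 ≤ N < EN/2) ≤ C · (P(o ↮ A) + max_{a,a'} P(a ↮ a'))`** on every finite
weighted graph — the threshold-`1/2` instance of `QuantLowerTailGluingAt`.  Provable with `C = 2` from `AdditiveGluing`
(QAG1-NOTE.md); the planner's hand-checked families (stars, brooms, chains, trees of near-cliques) give `C ≤ 1`.
builds on p205010 (kernel theorem, internal audit signed; external expert review pending).
[cite: KozmaNitzan2024, Conj. 1 (p. 3) and Conjecture 3 (p. 15)] -/
@[conjecture] def QuantLowerTailGluing (C : ℝ) : Prop :=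
  QuantLowerTailGluingAt (1 / 2) C

end Summit.CriticalPhenomena.PercolationContinuityZ3.Theorems.Quant
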